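import Mathlib
import Summits.Ventures.PercRepro2.RowC1AvoidAttract

/-!
# Exploring the `b`-avoiding cluster of `a₁`: the mirror identities and a generic tower
(blind cell PercRepro2, p2 g29; proofs/P2-G29-E1.md §2, part 4a)

With `K₁ = C_{G−b}(a₁)` (`avoidCluster ends b a₁`), for `a₁ ≠ b`:

* `cluster_eq_avoidCluster_of_not_conn`: on `{a₁ ↮ b}` the cluster of `a₁` is `K₁`;
* `bH_Q_iff'`: `b ↔ a₂ ∧ a₁ ↮ a₂` ⟺ `a₂ ∉ K₁` ∧ no edge from `b` into `K₁` is open ∧ `b ↔ a₂` in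
  `G − K₁`; `R_iff`: `a₁ ↮ a₂ ∧ a₁ ↮ b` ⟺ `a₂ ∉ K₁` ∧ no edge from `b` into `K₁` is open;
* `prob_avoidCluster_tower` / `expect_avoidCluster_tower`: the generic tower identity for the
  `b`-avoiding cluster of any root (the pattern of `RowC1AvoidTower.lean`, with an indicator or an
  arbitrary coefficient);
* the instances `prob_bH_Q_eq_expect'` (`P(Q, b ∈ C₂, K₁ ∈ 𝓒) = E[1_𝓒(K₁) 1[a₂ ∉ K₁] ρ₁(K₁) α₂(K₁)]`,
  `α₂ = P(b ↔ a₂ in G − ·)`), `prob_R_eq_expect` and `prob_Q_eq_expect'`.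

Used by `RowC1AvoidRepel.lean` (the `b`-avoiding repulsion `bH_avoidK1_repel`).
-/

namespace Summit.Ventures.PercRepro2

namespace RowC1

section CombMirror

variable {V : Type*} {E : Type*} {ends : E → Sym2 V}

/-- `b ∉ K₁ = C_{G−b}(a₁)` when `a₁ ≠ b`. -/
lemma b_notMem_avoidCluster {ω : Config E} {a₁ b : V} (hne : a₁ ≠ b) :
    b ∉ avoidCluster ends b a₁ ω := fun h =>
  hne (eq_of_conn_delConfig_of_mem (W := {b}) (x := b) rfl (conn_symm h))

/-- On `{a₁ ↮ b}` the cluster of `a₁` is its `b`-avoiding cluster. -/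
lemma cluster_eq_avoidCluster_of_not_conn {ω : Config E} {a₁ b : V} (h : ¬ Conn ends ω a₁ b) :
    cluster ends ω a₁ = avoidCluster ends b a₁ ω := by
  apply Set.Subset.antisymm
  · intro x hx
    -- every vertex reached from `a₁` is reached avoiding `b`
    have key : x ∈ {y | Conn ends (delConfig ends {b} ω) a₁ y} := by
      refine mem_of_conn_of_closed (ends := ends) (ω := ω) ?_ (conn_refl _ _ _) hx
      rintro y hy z hyz
      obtain ⟨_, e, he, hends⟩ := openGraph_adj.1 hyz
      by_cases hb : e ∈ touches ends {b}
      · exfalso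
        obtain ⟨w, hw, w', hww'⟩ := hb
        rw [Set.mem_singleton_iff] at hw
        rw [hw, hends] at hww'
        have hyω : Conn ends ω a₁ y := conn_mono (delConfig_singleton_le ends b ω) hy
        rcases Sym2.eq_iff.1 hww' with ⟨hyb, -⟩ | ⟨-, hzb⟩
        · exact h (hyb ▸ hyω)
        · exact h (hzb ▸ conn_trans hyω (conn_of_openAdj ⟨e, he, hends⟩))
      · refine conn_trans hy (conn_of_openAdj ⟨e, ?_, hends⟩)
        rw [delConfig_apply_of_notMem hb]; exact he
    exact key
  · intro x hx
    exact conn_mono (delConfig_singleton_le ends b ω) hx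

/-- `a₁ ↮ b` iff no edge from `b` into `K₁` is open (`a₁ ≠ b`). -/
lemma not_conn_iff_not_attach {ω : Config E} {a₁ b : V} (hne : a₁ ≠ b) :
    ¬ Conn ends ω a₁ b ↔ ¬ (∃ w ∈ avoidCluster ends b a₁ ω, OpenAdj ends ω b w) := by
  constructor
  · rintro h ⟨w, hw, hbw⟩
    exact h (conn_trans (conn_mono (delConfig_singleton_le ends b ω) hw)
      (conn_symm (conn_of_openAdj hbw)))
  · intro hno h
    obtain ⟨w, hw, hw'⟩ := exists_openAdj_of_conn hne h
    exact hno ⟨w, hw', hw⟩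

/-- **`Q ∩ {b ∈ C₂}` through `K₁`**: for `a₁ ≠ b`, `b ↔ a₂ ∧ a₁ ↮ a₂` iff `a₂ ∉ K₁`, no edge from
`b` into `K₁` is open, and `b ↔ a₂` in `G − K₁`. -/
lemma bH_Q_iff' {ω : Config E} {a₁ a₂ b : V} (hne : a₁ ≠ b) :
    (Conn ends ω a₂ b ∧ ¬ Conn ends ω a₁ a₂) ↔
      (a₂ ∉ avoidCluster ends b a₁ ω ∧
        ¬ (∃ w ∈ avoidCluster ends b a₁ ω, OpenAdj ends ω b w) ∧
        Conn ends (delConfig ends (avoidCluster ends b a₁ ω) ω) b a₂) := by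
  constructor
  · rintro ⟨hb, hQ⟩
    have hQ' : ¬ Conn ends ω a₂ a₁ := fun h => hQ (conn_symm h)
    have h1 : a₂ ∉ avoidCluster ends b a₁ ω :=
      ((Q_iff (a₁ := a₂) (a₂ := a₁) hne).1 hQ').1
    have hnb : ¬ Conn ends ω a₁ b := fun h => hQ (conn_trans h (conn_symm hb))
    refine ⟨h1, (not_conn_iff_not_attach hne).1 hnb, ?_⟩
    -- the open path from `b` to `a₂` avoids `K₁`: entering `K₁` would join `a₁` to `a₂`
    set K₁ := avoidCluster ends b a₁ ω with hK₁
    have hbK : b ∉ K₁ := b_notMem_avoidCluster hne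
    have key : a₂ ∈ {x | Conn ends (delConfig ends K₁ ω) b x} := by
      refine mem_of_conn_of_closed (ends := ends) (ω := ω) ?_ (conn_refl _ _ _) (conn_symm hb)
      rintro x hx y hxy
      obtain ⟨_, e, he, hends⟩ := openGraph_adj.1 hxy
      have hxK : x ∉ K₁ := fun hxK => hbK (by
        have := eq_of_conn_delConfig_of_mem (W := K₁) hxK (conn_symm hx)
        rw [this]; exact hxK)
      by_cases hK : e ∈ touches ends K₁
      · exfalso
        obtain ⟨z, hz, z', hzz'⟩ := hK
        rw [hends] at hzz'
        have hyK : y ∈ K₁ := by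
          rcases Sym2.eq_iff.1 hzz' with ⟨hxz, -⟩ | ⟨-, hyz⟩
          · exact absurd (hxz ▸ hz) hxK
          · exact hyz ▸ hz
        -- `y ∈ K₁` is joined to `a₁`; `x` is joined to `b`, hence to `a₂`: `a₁ ↔ a₂`
        have hxb : Conn ends ω b x := conn_mono (delConfig_le _ ω) hx
        have hya₁ : Conn ends ω a₁ y := conn_mono (delConfig_singleton_le ends b ω) hyK
        exact hQ (conn_trans hya₁ (conn_trans (conn_of_openAdj (OpenAdj.symm ⟨e, he, hends⟩))
          (conn_trans (conn_symm hxb) (conn_symm hb))))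
      · refine conn_trans hx (conn_of_openAdj ⟨e, ?_, hends⟩)
        rw [delConfig_apply_of_notMem hK]; exact he
    exact key
  · rintro ⟨h1, hno, hc⟩
    refine ⟨conn_symm (conn_mono (delConfig_le _ ω) hc), ?_⟩
    intro h
    exact ((Q_iff (a₁ := a₂) (a₂ := a₁) hne).2 ⟨h1, Or.inl hno⟩) (conn_symm h)

/-- **`{a₁ ↮ a₂} ∩ {a₁ ↮ b}` through `K₁`**: for `a₁ ≠ b`, iff `a₂ ∉ K₁` and no edge from `b` into
`K₁` is open. -/
lemma R_iff {ω : Config E} {a₁ a₂ b : V} (hne : a₁ ≠ b) :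
    (¬ Conn ends ω a₁ a₂ ∧ ¬ Conn ends ω a₁ b) ↔
      (a₂ ∉ avoidCluster ends b a₁ ω ∧ ¬ (∃ w ∈ avoidCluster ends b a₁ ω, OpenAdj ends ω b w)) := by
  constructor
  · rintro ⟨hQ, hb⟩
    exact ⟨((Q_iff (a₁ := a₂) (a₂ := a₁) hne).1 (fun h => hQ (conn_symm h))).1,
      (not_conn_iff_not_attach hne).1 hb⟩
  · rintro ⟨h1, hno⟩
    exact ⟨fun h => ((Q_iff (a₁ := a₂) (a₂ := a₁) hne).2 ⟨h1, Or.inl hno⟩) (conn_symm h),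
      (not_conn_iff_not_attach hne).2 hno⟩

end CombMirror

section TowerGeneric

variable {V : Type*} {E : Type*} [Fintype E] [DecidableEq E] [Fintype V]
  {R : Type*} [CommRing R]

/-- **Generic tower identity for the `b`-avoiding cluster** `K = C_{G−b}(r)`: if the event `A` is,
pointwise, «`K ∈ 𝓒`, `c₀ ∉ K`, and the fibre event `B(K)`», where `B(W)` is determined by the edges at
`b` and the edges not touching `W`, then `P(A) = E[1_𝓒(K) · 1[c₀ ∉ K] · P(B(K))]`. -/
theorem prob_avoidCluster_tower (p : E → R) (ends : E → Sym2 V) (r b c₀ : V) (𝓒 : Set (Set V))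
    (A : Set (Config E)) (B : Set V → Set (Config E))
    (hB : ∀ W, DependsOn (· ∈ B W) (touches ends {b} ∪ (touches ends W)ᶜ))
    (hpt : ∀ ω, ω ∈ A ↔ (avoidCluster ends b r ω ∈ 𝓒 ∧ c₀ ∉ avoidCluster ends b r ω ∧
      ω ∈ B (avoidCluster ends b r ω))) :
    prob p A = expect p (fun ω => coeffK 𝓒 c₀ (avoidCluster ends b r ω) *
      prob p (B (avoidCluster ends b r ω))) := by
  classical
  let Φ : Set V → Config E → R := fun W ω => coeffK 𝓒 c₀ W * (B W).indicator 1 ω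
  have hpt' : ∀ ω, A.indicator (1 : Config E → R) ω = Φ (avoidCluster ends b r ω) ω :=
    fun ω => indicator_eq_coeff_mul (hpt ω)
  have hΦ : ∀ W, DependsOn (Φ W) (touches ends W \ touches ends {b})ᶜ :=
    fun W => dependsOn_fibreObs ends b c₀ 𝓒 W (hB W)
  have hS : ∀ W : Set V, DependsOn (· ∈ {ω | avoidCluster ends b r ω = W})
      (touches ends W \ touches ends {b}) := fun W => dependsOn_avoidCluster_eq b r W
  have hdisj : ∀ W : Set V, Disjoint (touches ends W \ touches ends {b})
      (touches ends W \ touches ends {b})ᶜ := fun W => disjoint_compl_right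
  have hΦexp : ∀ W, expect p (Φ W) = coeffK 𝓒 c₀ W * prob p (B W) := by
    intro W
    simp only [Φ]
    rw [expect_const_mul, ← prob_eq_expect_indicator]
  rw [prob_eq_expect_indicator]
  have e1 : A.indicator (1 : Config E → R) = fun ω => Φ (avoidCluster ends b r ω) ω := funext hpt'
  rw [e1, expect_tower p hdisj (S := fun ω => avoidCluster ends b r ω) hS hΦ]
  simp only [hΦexp]
  rfl

omit [Fintype E] [DecidableEq E] [Fintype V] in
/-- The fibre observable with an arbitrary coefficient `c(W)` depends on the edges at `b` and the
edges not touching `W`. -/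
lemma dependsOn_fibreObs' (ends : E → Sym2 V) (b c₀ : V) (c : Set V → R) (W : Set V)
    {B : Set (Config E)} (hB : DependsOn (· ∈ B) (touches ends {b} ∪ (touches ends W)ᶜ)) :
    DependsOn (fun ω => c W * ({W' : Set V | c₀ ∉ W'} : Set (Set V)).indicator 1 W *
      B.indicator 1 ω) (touches ends W \ touches ends {b})ᶜ := by
  refine DependsOn.mono (union_subset_compl_sdiff b W) ?_
  intro ω ω' h
  simp only
  congr 1
  exact dependsOn_indicator (R := R) hB h

/-- **Generic tower identity with a coefficient**: for `c : Set V → R`, if `ω ∈ A'` is, pointwise,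
«`c₀ ∉ K` and the fibre event `B(K)`», then `E[c(K) 1_{A'}] = E[c(K) 1[c₀ ∉ K] P(B(K))]`. -/
theorem expect_avoidCluster_tower (p : E → R) (ends : E → Sym2 V) (r b c₀ : V) (c : Set V → R)
    (A' : Set (Config E)) (B : Set V → Set (Config E))
    (hB : ∀ W, DependsOn (· ∈ B W) (touches ends {b} ∪ (touches ends W)ᶜ))
    (hpt : ∀ ω, ω ∈ A' ↔ (c₀ ∉ avoidCluster ends b r ω ∧ ω ∈ B (avoidCluster ends b r ω))) :
    expect p (fun ω => c (avoidCluster ends b r ω) * A'.indicator 1 ω) =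
      expect p (fun ω => c (avoidCluster ends b r ω) *
        ({W' : Set V | c₀ ∉ W'} : Set (Set V)).indicator 1 (avoidCluster ends b r ω) *
        prob p (B (avoidCluster ends b r ω))) := by
  classical
  let Φ : Set V → Config E → R := fun W ω =>
    c W * ({W' : Set V | c₀ ∉ W'} : Set (Set V)).indicator 1 W * (B W).indicator 1 ω
  have hpt' : ∀ ω, c (avoidCluster ends b r ω) * A'.indicator (1 : Config E → R) ω =
      Φ (avoidCluster ends b r ω) ω := by
    intro ω
    simp only [Φ]
    by_cases h1 : c₀ ∉ avoidCluster ends b r ω <;> by_cases h2 : ω ∈ B (avoidCluster ends b r ω) <;>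
      simp [h1, h2, hpt]
  have hΦ : ∀ W, DependsOn (Φ W) (touches ends W \ touches ends {b})ᶜ :=
    fun W => dependsOn_fibreObs' ends b c₀ c W (hB W)
  have hS : ∀ W : Set V, DependsOn (· ∈ {ω | avoidCluster ends b r ω = W})
      (touches ends W \ touches ends {b}) := fun W => dependsOn_avoidCluster_eq b r W
  have hdisj : ∀ W : Set V, Disjoint (touches ends W \ touches ends {b})
      (touches ends W \ touches ends {b})ᶜ := fun W => disjoint_compl_right
  have hΦexp : ∀ W, expect p (Φ W) = c W *
      ({W' : Set V | c₀ ∉ W'} : Set (Set V)).indicator 1 W * prob p (B W) := by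
    intro W
    simp only [Φ]
    rw [expect_const_mul, ← prob_eq_expect_indicator]
  have e1 : (fun ω => c (avoidCluster ends b r ω) * A'.indicator (1 : Config E → R) ω) =
      fun ω => Φ (avoidCluster ends b r ω) ω := funext hpt'
  rw [e1, expect_tower p hdisj (S := fun ω => avoidCluster ends b r ω) hS hΦ]
  simp only [hΦexp]
  rfl

end TowerGeneric

section TowerMirror

variable {V : Type*} {E : Type*} [Fintype E] [DecidableEq E] [Fintype V]
  {R : Type*} [CommRing R]

/-- `α₂(W) = P(b ↔ a₂ in G − W)`. -/
noncomputable def delConnProb (p : E → R) (ends : E → Sym2 V) (b a₂ : V) (W : Set V) : R :=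
  prob p (delAvoidEvent ends W b a₂)ᶜ

omit [Fintype V] in
/-- `α₂ = 1 − ζ₂`. -/
lemma delConnProb_eq (p : E → R) (ends : E → Sym2 V) (b a₂ : V) (W : Set V) :
    delConnProb p ends b a₂ W = 1 - delAvoidProb p ends b a₂ W :=
  prob_compl p _

omit [Fintype V] in
/-- Independence of the non-attachment and the connection: `P(attachᶜ ∩ delAvoidᶜ) = ρ · α`. -/
lemma prob_noAttach_inter_delConn (p : E → R) (ends : E → Sym2 V) (b a₂ : V) (W : Set V) :
    prob p ((attachEvent ends b W)ᶜ ∩ (delAvoidEvent ends W b a₂)ᶜ) =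
      noAttachProb p ends b W * delConnProb p ends b a₂ W :=
  prob_inter_eq_mul_of_dependsOn p (disjoint_attach_delAvoid b W)
    (dependsOn_compl (dependsOn_attachEvent b W)) (dependsOn_compl (dependsOn_delAvoidEvent W b a₂))

/-- **Tower identity for `Q ∩ {b ∈ C₂}` through `K₁`**: for `a₁ ≠ b`,
`P(Q, b ∈ C₂, K₁ ∈ 𝓒) = E[1_𝓒(K₁) 1[a₂ ∉ K₁] ρ₁(K₁) α₂(K₁)]`. -/
theorem prob_bH_Q_eq_expect' (p : E → R) (ends : E → Sym2 V) (a₁ a₂ b : V) (hne : a₁ ≠ b)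
    (𝓒 : Set (Set V)) :
    prob p (connEvent ends a₂ b ∩ (connEvent ends a₁ a₂)ᶜ ∩ {ω | avoidCluster ends b a₁ ω ∈ 𝓒}) =
      expect p (fun ω => coeffK 𝓒 a₂ (avoidCluster ends b a₁ ω) *
        (noAttachProb p ends b (avoidCluster ends b a₁ ω) *
          delConnProb p ends b a₂ (avoidCluster ends b a₁ ω))) := by
  have := prob_avoidCluster_tower p ends a₁ b a₂ 𝓒
    (connEvent ends a₂ b ∩ (connEvent ends a₁ a₂)ᶜ ∩ {ω | avoidCluster ends b a₁ ω ∈ 𝓒})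
    (fun W => (attachEvent ends b W)ᶜ ∩ (delAvoidEvent ends W b a₂)ᶜ)
    (fun W => dependsOn_inter ((dependsOn_compl (dependsOn_attachEvent b W)).mono
      Set.inter_subset_left) (dependsOn_compl (dependsOn_delAvoidEvent W b a₂)))
    (fun ω => by
      simp only [Set.mem_inter_iff, Set.mem_compl_iff, Set.mem_setOf_eq, mem_connEvent]
      rw [and_comm, and_congr_right_iff]
      intro _
      exact (bH_Q_iff' hne).trans (by
        simp only [avoidCluster, attachEvent, delAvoidEvent, Set.mem_setOf_eq, not_not]))
  rw [this]
  simp only [prob_noAttach_inter_delConn]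

/-- **Tower identity for `{a₁ ↮ a₂} ∩ {a₁ ↮ b}` through `K₁`**: for `a₁ ≠ b`,
`P(a₁ ↮ a₂, a₁ ↮ b, K₁ ∈ 𝓒) = E[1_𝓒(K₁) 1[a₂ ∉ K₁] ρ₁(K₁)]`. -/
theorem prob_R_eq_expect (p : E → R) (ends : E → Sym2 V) (a₁ a₂ b : V) (hne : a₁ ≠ b)
    (𝓒 : Set (Set V)) :
    prob p ((connEvent ends a₁ a₂)ᶜ ∩ (connEvent ends a₁ b)ᶜ ∩
        {ω | avoidCluster ends b a₁ ω ∈ 𝓒}) =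
      expect p (fun ω => coeffK 𝓒 a₂ (avoidCluster ends b a₁ ω) *
        noAttachProb p ends b (avoidCluster ends b a₁ ω)) := by
  exact prob_avoidCluster_tower p ends a₁ b a₂ 𝓒
    ((connEvent ends a₁ a₂)ᶜ ∩ (connEvent ends a₁ b)ᶜ ∩ {ω | avoidCluster ends b a₁ ω ∈ 𝓒})
    (fun W => (attachEvent ends b W)ᶜ)
    (fun W => (dependsOn_compl (dependsOn_attachEvent b W)).mono
      (Set.inter_subset_left.trans Set.subset_union_left))
    (fun ω => by
      simp only [Set.mem_inter_iff, Set.mem_compl_iff, Set.mem_setOf_eq, mem_connEvent]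
      rw [and_comm, and_congr_right_iff]
      intro _
      exact (R_iff hne).trans (by
        simp only [avoidCluster, attachEvent, Set.mem_setOf_eq]))

/-- **Tower identity for `Q` through `K₁`**: for `a₁ ≠ b`,
`P(Q, K₁ ∈ 𝓒) = E[1_𝓒(K₁) 1[a₂ ∉ K₁] (ρ₁ + σ₁ ζ₂)(K₁)]` (`prob_Q_eq_expect` with the roots
exchanged). -/
theorem prob_Q_eq_expect' (p : E → R) (ends : E → Sym2 V) (a₁ a₂ b : V) (hne : a₁ ≠ b)
    (𝓒 : Set (Set V)) :
    prob p ((connEvent ends a₁ a₂)ᶜ ∩ {ω | avoidCluster ends b a₁ ω ∈ 𝓒}) =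
      expect p (fun ω => coeffK 𝓒 a₂ (avoidCluster ends b a₁ ω) *
        (noAttachProb p ends b (avoidCluster ends b a₁ ω) +
          attachProb p ends b (avoidCluster ends b a₁ ω) *
            delAvoidProb p ends b a₂ (avoidCluster ends b a₁ ω))) := by
  rw [connEvent_comm ends a₁ a₂]
  exact prob_Q_eq_expect p ends a₂ a₁ b hne 𝓒

end TowerMirror
end RowC1

end Summit.Ventures.PercRepro2
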